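import Mathlib
import Summits.Ventures.PercRepro2.A3PendantFreeRow

/-!
# (FM) at the marks `o` and `b`: BHK 1.4 and the cross-weighted BHK inequality
(blind cell PercRepro2, night-1 g31; proofs/NIGHT1-G31.md §3″)

At a MARK the first-order functional collapses to a polynomial in the `Q`-masses (on the fibres of
`C(x)` the mark `x` itself has `Ssig_x W = s3 W · m_W`, `Su_x W = (s3 W)² · m_W`, A3FibreMark):

* **`FMfun_self_o`**: `FMfun(o) = m_o · T₀ / P(Q)³` — (FM) at `o` is BHK 1.4 (`LeafStep.T0_nonneg`),
  **`FM_self_o`**;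
* **`FMfun_self_b`**: `FMfun(b) = 2 · CW / P(Q)²` with `CW` the cleared cross-weighted BHK form of
  `CrossWeighted.crossWeighted_nonneg` (night-1 g29's (FM-b)), **`FM_self_b`**.

With `FMfun_leaf` (A3PendantFreeLeaf.lean) (FM) therefore holds at every vertex that is a leaf at `o`
or at `b` — the means-level reason behind the class theorems `A3Between_pendant_o` / `_b` of g30, now
read off the single identity `btw_leaf_free`.  Standard axioms.
-/

namespace Summit.Ventures.PercRepro2

open UnionCluster CovForm PendantRoot PendantO

namespace CovForm

namespace A3Fibre

section SelfFibres

variable {V : Type*} {E : Type*} [Fintype V] [DecidableEq V] [Fintype E] [DecidableEq E]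
  {R : Type*} [Field R] [LinearOrder R] [IsStrictOrderedRing R]

omit [Fintype V] [LinearOrder R] [IsStrictOrderedRing R] in
/-- On the fibres of `x`, `Ssig_x W = s3 W · m_W` for every `W`. -/
lemma Ssig_self (p : E → R) (ends : E → Sym2 V) (a₁ a₂ x : V) (W : Finset V) :
    Ssig p ends a₁ a₂ x x W = s3 a₁ a₂ W * mW p ends a₁ a₂ x W := by
  by_cases hx : x ∈ W
  · exact Ssig_eq_of_mem p ends a₁ a₂ x x W hx
  · rw [Ssig_eq_zero_of_notMem_self p ends a₁ a₂ x x hx, mW_eq_zero_of_notMem_self p ends a₁ a₂ x hx,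
      mul_zero]

omit [Fintype V] [LinearOrder R] [IsStrictOrderedRing R] in
/-- On the fibres of `x`, `Su_x W = (s3 W)² · m_W` for every `W`. -/
lemma Su_self (p : E → R) (ends : E → Sym2 V) (a₁ a₂ x : V) (W : Finset V) :
    Su p ends a₁ a₂ x x W = s3 a₁ a₂ W ^ 2 * mW p ends a₁ a₂ x W := by
  by_cases hx : x ∈ W
  · exact Su_eq_of_mem p ends a₁ a₂ x x W hx
  · rw [Su_eq_zero_of_notMem_self p ends a₁ a₂ x x hx, mW_eq_zero_of_notMem_self p ends a₁ a₂ x hx,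
      mul_zero]

omit [Fintype E] [DecidableEq E] [LinearOrder R] [IsStrictOrderedRing R] in
/-- `s3 W = 0` on an `A`-fibre. -/
lemma s3_eq_zero_of_mem_fibresA {a₁ a₂ : V} {W : Finset V} (hW : W ∈ fibresA a₁ a₂) :
    (s3 a₁ a₂ W : R) = 0 := by
  rw [fibresA, Finset.mem_filter] at hW
  unfold s3
  simp [hW.2.1, hW.2.2]

omit [Fintype V] [LinearOrder R] [IsStrictOrderedRing R] in
/-- `SFg` on the fibres of `o` itself: `SFg(o, γ, W) = γ · s3 W · m_W` (`s3³ = s3`). -/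
lemma SFg_self_o (p : E → R) (ends : E → Sym2 V) (o a₁ a₂ : V) (γ : R) (W : Finset V) :
    RootEdge.SFg p ends o a₁ a₂ o γ W = γ * s3 a₁ a₂ W * mW p ends a₁ a₂ o W := by
  unfold RootEdge.SFg
  rw [Ssig_self, Su_self]
  have h := s3_pow_three (R := R) a₁ a₂ W
  linear_combination (-(mW p ends a₁ a₂ o W)) * h

omit [LinearOrder R] [IsStrictOrderedRing R] in
/-- The `A`-ratio sum vanishes on the fibres of a mark `x` (`Su_x = 0` there). -/
lemma sum_termA_self (p : E → R) (ends : E → Sym2 V) (a₁ a₂ x y : V) :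
    ∑ W ∈ fibresA a₁ a₂, Su p ends a₁ a₂ x y W * Su p ends a₁ a₂ x x W / mW p ends a₁ a₂ x W = 0 :=
  Finset.sum_eq_zero fun W hW => by
    rw [Su_self, s3_eq_zero_of_mem_fibresA hW]
    ring

omit [LinearOrder R] [IsStrictOrderedRing R] in
/-- The `A`-sum of `Su_x` vanishes on the fibres of the mark `x`. -/
lemma sum_SuA_self (p : E → R) (ends : E → Sym2 V) (a₁ a₂ x : V) :
    ∑ W ∈ fibresA a₁ a₂, Su p ends a₁ a₂ x x W = 0 :=
  Finset.sum_eq_zero fun W hW => by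
    rw [Su_self, s3_eq_zero_of_mem_fibresA hW]
    ring

end SelfFibres

/-! ## The `a₃ := o` moments in the `Q`-masses -/

section SelfMasses

variable {V : Type*} {E : Type*} [Fintype V] [DecidableEq V] [Fintype E] [DecidableEq E]
  {R : Type*} [Field R] [LinearOrder R] [IsStrictOrderedRing R]

omit [Fintype V] [DecidableEq V] [LinearOrder R] [IsStrictOrderedRing R] in
/-- `E_Q[σ_b σ_x] = EQbo(x, b)` with `x` in the role of `a₃`. -/
lemma EQb3_self (p : E → R) (ends : E → Sym2 V) (x a₁ a₂ b : V) :
    EQb3 p ends a₁ a₂ x b = EQbo p ends x a₁ a₂ b := by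
  unfold EQb3 EQbo
  rw [LeafStep.prob_T'_inter_v p ends a₁ a₂ x (connEvent ends a₁ b),
    LeafStep.prob_T_inter_v p ends a₁ a₂ x (connEvent ends a₂ b),
    LeafStep.prob_T_inter_v p ends a₁ a₂ x (connEvent ends a₁ b),
    LeafStep.prob_T'_inter_v p ends a₁ a₂ x (connEvent ends a₂ b)]

omit [Fintype V] [DecidableEq V] [LinearOrder R] [IsStrictOrderedRing R] in
/-- `E_Q[σ_x] = EQo(x)` with `x` in the role of `a₃`. -/
lemma EQ3_self (p : E → R) (ends : E → Sym2 V) (x a₁ a₂ : V) :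
    EQ3 p ends a₁ a₂ x = EQo p ends x a₁ a₂ := by
  unfold EQ3 EQo
  rw [LeafStep.prob_T'_v p ends a₁ a₂ x, LeafStep.prob_T_v p ends a₁ a₂ x]

omit [Fintype V] in
/-- `P(PD_x, b ∈ U) = m_b − P(Q, x ∈ U, b ∈ U)`. -/
lemma PDb_self (p : E → R) (ends : E → Sym2 V) (x a₁ a₂ b : V) :
    PDb p ends a₁ a₂ x b = LeafStep.mU p ends a₁ a₂ b - LeafStep.mUU p ends x a₁ a₂ b := by
  unfold PDb LeafStep.mU LeafStep.mUU
  rw [LeafStep.prob_PD_inter_v p ends a₁ a₂ x (connEvent ends a₁ b),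
    LeafStep.prob_PD_inter_v p ends a₁ a₂ x (connEvent ends a₂ b)]
  ring

omit [Fintype V] in
/-- `P(PD_x) = P(Q) − m_x`. -/
lemma prob_PD_self (p : E → R) (ends : E → Sym2 V) (x a₁ a₂ : V) :
    prob p (PDEvent ends a₁ a₂ x) = prob p (avoidAll ends a₂ {a₁}) - LeafStep.mU p ends a₁ a₂ x := by
  unfold LeafStep.mU
  rw [LeafStep.prob_PD_v p ends a₁ a₂ x]
  ring

end SelfMasses

/-! ## (FM) at `o` is BHK 1.4 -/

section AtO

variable {V : Type*} {E : Type*} [Fintype V] [DecidableEq V] [Fintype E] [DecidableEq E]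
  {R : Type*} [Field R] [LinearOrder R] [IsStrictOrderedRing R]

/-- **(FM) at `o`**: `FMfun(o) = m_o · T₀ / P(Q)³`. -/
theorem FMfun_self_o {p : E → R} (hp : IsProbVec p) (ends : E → Sym2 V) (o a₁ a₂ b : V)
    (hQ : prob p (avoidAll ends a₂ {a₁}) ≠ 0) :
    FMfun p ends o a₁ a₂ o b =
      LeafStep.mU p ends a₁ a₂ o * LeafStep.T0 p ends o a₁ a₂ b / prob p (avoidAll ends a₂ {a₁}) ^ 3 := by
  unfold FMfun gamma0
  have h1 : ∀ W : Finset V, Ssig p ends a₁ a₂ o b W *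
      RootEdge.SFg p ends o a₁ a₂ o (LeafStep.mU p ends a₁ a₂ o / prob p (avoidAll ends a₂ {a₁})) W /
        mW p ends a₁ a₂ o W =
      LeafStep.mU p ends a₁ a₂ o / prob p (avoidAll ends a₂ {a₁}) * (s3 a₁ a₂ W * Ssig p ends a₁ a₂ o b W) := by
    intro W
    rw [SFg_self_o]
    by_cases hm : mW p ends a₁ a₂ o W = 0
    · rw [hm, Ssig_eq_zero_of_mW_eq_zero hp ends a₁ a₂ o b W hm]
      ring
    · field_simp
  rw [Finset.sum_congr rfl (fun W _ => h1 W), ← Finset.mul_sum, ← EQb3_eq,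
    Finset.sum_congr rfl (fun W _ => SFg_self_o p ends o a₁ a₂ _ W)]
  have h2 : ∑ W : Finset V, LeafStep.mU p ends a₁ a₂ o / prob p (avoidAll ends a₂ {a₁}) * s3 a₁ a₂ W *
      mW p ends a₁ a₂ o W = LeafStep.mU p ends a₁ a₂ o / prob p (avoidAll ends a₂ {a₁}) *
        EQ3 p ends a₁ a₂ o := by
    rw [EQ3_eq, Finset.mul_sum]
    refine Finset.sum_congr rfl fun W _ => ?_
    ring
  rw [h2, sum_termA_self, sum_SuA_self, ← EQo_eq p ends b a₁ a₂ o, fibresA, Finset.sum_filter, ← PDb_eq,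
    EQb3_self, EQ3_self, PDb_self, prob_PD_self]
  unfold LeafStep.T0 EQbo EQo LeafStep.mU LeafStep.mUU
  rw [gap_eq_Q]
  field_simp
  ring

/-- **(FM) holds at `o`** (BHK 1.4). -/
theorem FM_self_o {p : E → R} (hp : IsProbVec p) (ends : E → Sym2 V) (o a₁ a₂ b : V) :
    0 ≤ FMfun p ends o a₁ a₂ o b := by
  rcases eq_or_ne (prob p (avoidAll ends a₂ {a₁})) 0 with hQ | hQ
  · -- every fibre is null: `FMfun = 0`
    have hz : ∀ W : Finset V, mW p ends a₁ a₂ o W = 0 := fun W =>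
      le_antisymm (hQ ▸ prob_mono hp (Set.inter_subset_left : fibre ends a₁ a₂ o W ⊆ _))
        (prob_nonneg hp _)
    have hS : ∀ W : Finset V, Ssig p ends a₁ a₂ o b W = 0 := fun W =>
      Ssig_eq_zero_of_mW_eq_zero hp ends a₁ a₂ o b W (hz W)
    have hU : ∀ W : Finset V, Su p ends a₁ a₂ o b W = 0 := fun W =>
      Su_eq_zero_of_mW_eq_zero hp ends a₁ a₂ o b W (hz W)
    have hUo : ∀ W : Finset V, Su p ends a₁ a₂ o o W = 0 := fun W =>
      Su_eq_zero_of_mW_eq_zero hp ends a₁ a₂ o o W (hz W)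
    unfold FMfun
    simp [hS, hU, hUo, hz, hQ]
  · rw [FMfun_self_o hp ends o a₁ a₂ b hQ]
    have hT := LeafStep.T0_nonneg p ends hp o a₁ a₂ b
    have hm : 0 ≤ LeafStep.mU p ends a₁ a₂ o :=
      add_nonneg (prob_nonneg hp _) (prob_nonneg hp _)
    exact div_nonneg (mul_nonneg hm hT) (pow_nonneg (prob_nonneg hp _) 3)

end AtO

/-! ## (FM) at `b` is the cross-weighted BHK inequality -/

section AtB

variable {V : Type*} {E : Type*} [Fintype V] [DecidableEq V] [Fintype E] [DecidableEq E]
  {R : Type*} [Field R] [LinearOrder R] [IsStrictOrderedRing R]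

omit [LinearOrder R] [IsStrictOrderedRing R] in
/-- The `A`-ratio sum vanishes on the fibres of a mark `x` (self factor first). -/
lemma sum_termA_self' (p : E → R) (ends : E → Sym2 V) (a₁ a₂ x y : V) :
    ∑ W ∈ fibresA a₁ a₂, Su p ends a₁ a₂ x x W * Su p ends a₁ a₂ x y W / mW p ends a₁ a₂ x W = 0 :=
  Finset.sum_eq_zero fun W hW => by
    rw [Su_self, s3_eq_zero_of_mem_fibresA hW]
    ring

omit [Fintype V] in
/-- On the fibres of `b`, `(s3 W)² · Su_o W` is the sum of the two root indicators times `Su_o W`. -/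
lemma s3_sq_mul_Su {p : E → R} (hp : IsProbVec p) (ends : E → Sym2 V) (o a₁ a₂ b : V) (W : Finset V) :
    (s3 a₁ a₂ W : R) ^ 2 * Su p ends a₁ a₂ b o W =
      (if a₁ ∈ W then Su p ends a₁ a₂ b o W else 0) + (if a₂ ∈ W then Su p ends a₁ a₂ b o W else 0) := by
  by_cases h₁ : a₁ ∈ W <;> by_cases h₂ : a₂ ∈ W
  · rw [Su_eq_zero_of_mW_eq_zero hp ends a₁ a₂ b o W (mW_eq_zero_of_mem_mem p ends a₁ a₂ b h₁ h₂)]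
    simp
  · unfold s3; simp [h₁, h₂]
  · unfold s3; simp [h₁, h₂]
  · unfold s3; simp [h₁, h₂]

/-- `∑_W (s3 W)² · Su_o W = P(Q, b ∈ U, o ∈ U)` on the fibres of `b`. -/
lemma sum_s3_sq_Su {p : E → R} (hp : IsProbVec p) (ends : E → Sym2 V) (o a₁ a₂ b : V) :
    ∑ W : Finset V, (s3 a₁ a₂ W : R) ^ 2 * Su p ends a₁ a₂ b o W =
      prob p (avoidAll ends a₂ {a₁} ∩ (connEvent ends a₁ b ∩ connEvent ends a₁ o)) +
        prob p (avoidAll ends a₂ {a₁} ∩ (connEvent ends a₁ b ∩ connEvent ends a₂ o)) +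
        (prob p (avoidAll ends a₂ {a₁} ∩ (connEvent ends a₂ b ∩ connEvent ends a₁ o)) +
          prob p (avoidAll ends a₂ {a₁} ∩ (connEvent ends a₂ b ∩ connEvent ends a₂ o))) := by
  rw [Finset.sum_congr rfl (fun W _ => s3_sq_mul_Su hp ends o a₁ a₂ b W), Finset.sum_add_distrib]
  have h1 : ∑ W : Finset V, (if a₁ ∈ W then Su p ends a₁ a₂ b o W else 0) =
      prob p (TEvent ends a₂ a₁ b ∩ connEvent ends a₁ o) +
        prob p (TEvent ends a₂ a₁ b ∩ connEvent ends a₂ o) := by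
    rw [prob_T'_inter, prob_T'_inter, ← Finset.sum_add_distrib]
    refine Finset.sum_congr rfl fun W _ => ?_
    unfold Su
    split_ifs <;> ring
  have h2 : ∑ W : Finset V, (if a₂ ∈ W then Su p ends a₁ a₂ b o W else 0) =
      prob p (TEvent ends a₁ a₂ b ∩ connEvent ends a₁ o) +
        prob p (TEvent ends a₁ a₂ b ∩ connEvent ends a₂ o) := by
    rw [prob_T_inter, prob_T_inter, ← Finset.sum_add_distrib]
    refine Finset.sum_congr rfl fun W _ => ?_
    unfold Su
    split_ifs <;> ring
  rw [h1, h2, LeafStep.prob_T'_inter_v p ends a₁ a₂ b (connEvent ends a₁ o),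
    LeafStep.prob_T'_inter_v p ends a₁ a₂ b (connEvent ends a₂ o),
    LeafStep.prob_T_inter_v p ends a₁ a₂ b (connEvent ends a₁ o),
    LeafStep.prob_T_inter_v p ends a₁ a₂ b (connEvent ends a₂ o)]

omit [Fintype V] [DecidableEq V] [LinearOrder R] [IsStrictOrderedRing R] in
/-- `E_Q[σ_b U_o]` in the `Q`-masses. -/
lemma EQ3o_self (p : E → R) (ends : E → Sym2 V) (o a₁ a₂ b : V) :
    EQ3o p ends o a₁ a₂ b =
      prob p (avoidAll ends a₂ {a₁} ∩ (connEvent ends a₁ b ∩ connEvent ends a₁ o)) +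
        prob p (avoidAll ends a₂ {a₁} ∩ (connEvent ends a₁ b ∩ connEvent ends a₂ o)) -
        prob p (avoidAll ends a₂ {a₁} ∩ (connEvent ends a₂ b ∩ connEvent ends a₁ o)) -
        prob p (avoidAll ends a₂ {a₁} ∩ (connEvent ends a₂ b ∩ connEvent ends a₂ o)) := by
  unfold EQ3o
  rw [LeafStep.prob_T'_inter_v p ends a₁ a₂ b (connEvent ends a₁ o),
    LeafStep.prob_T'_inter_v p ends a₁ a₂ b (connEvent ends a₂ o),
    LeafStep.prob_T_inter_v p ends a₁ a₂ b (connEvent ends a₁ o),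
    LeafStep.prob_T_inter_v p ends a₁ a₂ b (connEvent ends a₂ o)]

omit [Fintype V] in
/-- `D_o` with `b` in the role of `a₃`: `P(PD_b, o ∈ U) = m_o − P(Q, b ∈ U, o ∈ U)`. -/
lemma Do_self (p : E → R) (ends : E → Sym2 V) (o a₁ a₂ b : V) :
    Do p ends o a₁ a₂ b =
      prob p (avoidAll ends a₂ {a₁} ∩ connEvent ends a₁ o) +
        prob p (avoidAll ends a₂ {a₁} ∩ connEvent ends a₂ o) -
        (prob p (avoidAll ends a₂ {a₁} ∩ (connEvent ends a₁ b ∩ connEvent ends a₁ o)) +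
          prob p (avoidAll ends a₂ {a₁} ∩ (connEvent ends a₁ b ∩ connEvent ends a₂ o)) +
          (prob p (avoidAll ends a₂ {a₁} ∩ (connEvent ends a₂ b ∩ connEvent ends a₁ o)) +
            prob p (avoidAll ends a₂ {a₁} ∩ (connEvent ends a₂ b ∩ connEvent ends a₂ o)))) := by
  unfold Do
  rw [LeafStep.prob_PD_inter_v p ends a₁ a₂ b (connEvent ends a₁ o),
    LeafStep.prob_PD_inter_v p ends a₁ a₂ b (connEvent ends a₂ o)]
  ring

/-- **(FM) at `b`**: `FMfun(b) = 2 · CW / P(Q)²`, `CW` the cleared cross-weighted BHK form of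
`CrossWeighted.crossWeighted_nonneg`. -/
theorem FMfun_self_b {p : E → R} (hp : IsProbVec p) (ends : E → Sym2 V) (o a₁ a₂ b : V)
    (hQ : prob p (avoidAll ends a₂ {a₁}) ≠ 0) :
    FMfun p ends o a₁ a₂ b b =
      2 * ((prob p (avoidAll ends a₂ {a₁}) + prob p (avoidAll ends a₂ {a₁} ∩ connEvent ends a₂ b)) *
          (prob p (avoidAll ends a₂ {a₁} ∩ connEvent ends a₁ b) *
              prob p (avoidAll ends a₂ {a₁} ∩ connEvent ends a₂ o) -
            prob p (avoidAll ends a₂ {a₁}) *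
              prob p (avoidAll ends a₂ {a₁} ∩ connEvent ends a₁ b ∩ connEvent ends a₂ o)) +
        (prob p (avoidAll ends a₂ {a₁}) + prob p (avoidAll ends a₂ {a₁} ∩ connEvent ends a₁ b)) *
          (prob p (avoidAll ends a₂ {a₁} ∩ connEvent ends a₂ b) *
              prob p (avoidAll ends a₂ {a₁} ∩ connEvent ends a₁ o) -
            prob p (avoidAll ends a₂ {a₁}) *
              prob p (avoidAll ends a₂ {a₁} ∩ connEvent ends a₂ b ∩ connEvent ends a₁ o)) -
        prob p (avoidAll ends a₂ {a₁} ∩ connEvent ends a₂ b) *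
          (prob p (avoidAll ends a₂ {a₁}) *
              prob p (avoidAll ends a₂ {a₁} ∩ connEvent ends a₁ b ∩ connEvent ends a₁ o) -
            prob p (avoidAll ends a₂ {a₁} ∩ connEvent ends a₁ b) *
              prob p (avoidAll ends a₂ {a₁} ∩ connEvent ends a₁ o)) -
        prob p (avoidAll ends a₂ {a₁} ∩ connEvent ends a₁ b) *
          (prob p (avoidAll ends a₂ {a₁}) *
              prob p (avoidAll ends a₂ {a₁} ∩ connEvent ends a₂ b ∩ connEvent ends a₂ o) -
            prob p (avoidAll ends a₂ {a₁} ∩ connEvent ends a₂ b) *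
              prob p (avoidAll ends a₂ {a₁} ∩ connEvent ends a₂ o))) /
        prob p (avoidAll ends a₂ {a₁}) ^ 2 := by
  unfold FMfun gamma0
  -- the ratio terms collapse: `Ssig_b = s3 · m_W`
  have h1 : ∀ W : Finset V, Ssig p ends a₁ a₂ b b W *
      RootEdge.SFg p ends o a₁ a₂ b (LeafStep.mU p ends a₁ a₂ o / prob p (avoidAll ends a₂ {a₁})) W /
        mW p ends a₁ a₂ b W =
      s3 a₁ a₂ W * Ssig p ends a₁ a₂ b o W +
        LeafStep.mU p ends a₁ a₂ o / prob p (avoidAll ends a₂ {a₁}) * (s3 a₁ a₂ W ^ 2 * mW p ends a₁ a₂ b W) -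
        s3 a₁ a₂ W ^ 2 * Su p ends a₁ a₂ b o W := by
    intro W
    rw [Ssig_self]
    by_cases hm : mW p ends a₁ a₂ b W = 0
    · rw [hm, Ssig_eq_zero_of_mW_eq_zero hp ends a₁ a₂ b o W hm, Su_eq_zero_of_mW_eq_zero hp ends a₁ a₂ b o W hm]
      ring
    · unfold RootEdge.SFg
      field_simp
      ring
  rw [Finset.sum_congr rfl (fun W _ => h1 W), Finset.sum_sub_distrib, Finset.sum_add_distrib,
    ← Finset.mul_sum, ← EQb3_eq, sum_s3_sq_Su hp]
  have h2 : ∑ W : Finset V, (s3 a₁ a₂ W : R) ^ 2 * mW p ends a₁ a₂ b W = LeafStep.mU p ends a₁ a₂ b := by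
    unfold LeafStep.mU
    rw [← sum_Su p ends a₁ a₂ b b]
    exact Finset.sum_congr rfl fun W _ => (Su_self p ends a₁ a₂ b W).symm
  rw [h2, Finset.sum_congr rfl (fun W _ => Ssig_self p ends a₁ a₂ b W), ← EQ3_eq,
    sum_SFg_affine, sum_SFg_zero, ← EQo_eq p ends o a₁ a₂ b, ← EQ3_eq, ← EQ3o_eq, sum_termA_self',
    sum_SuA_self, fibresA, Finset.sum_filter, ← Do_eq, EQb3_self, EQ3_self, EQ3o_self, Do_self,
    prob_PD_self]
  unfold EQbo EQo LeafStep.mU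
  simp only [Set.inter_comm, Set.inter_left_comm]
  field_simp
  ring

/-- **(FM) holds at `b`** (the cross-weighted BHK inequality, night-1 g29). -/
theorem FM_self_b {p : E → R} (hp : IsProbVec p) (ends : E → Sym2 V) (o a₁ a₂ b : V) :
    0 ≤ FMfun p ends o a₁ a₂ b b := by
  rcases eq_or_ne (prob p (avoidAll ends a₂ {a₁})) 0 with hQ | hQ
  · have hz : ∀ W : Finset V, mW p ends a₁ a₂ b W = 0 := fun W =>
      le_antisymm (hQ ▸ prob_mono hp (Set.inter_subset_left : fibre ends a₁ a₂ b W ⊆ _))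
        (prob_nonneg hp _)
    have hS : ∀ W : Finset V, Ssig p ends a₁ a₂ b b W = 0 := fun W =>
      Ssig_eq_zero_of_mW_eq_zero hp ends a₁ a₂ b b W (hz W)
    have hU : ∀ W : Finset V, Su p ends a₁ a₂ b b W = 0 := fun W =>
      Su_eq_zero_of_mW_eq_zero hp ends a₁ a₂ b b W (hz W)
    have hUo : ∀ W : Finset V, Su p ends a₁ a₂ b o W = 0 := fun W =>
      Su_eq_zero_of_mW_eq_zero hp ends a₁ a₂ b o W (hz W)
    unfold FMfun
    simp [hS, hU, hUo, hz, hQ]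
  · rw [FMfun_self_b hp ends o a₁ a₂ b hQ]
    have hCW := CrossWeighted.crossWeighted_nonneg p hp ends o a₁ a₂ b
    have h2 : (0 : R) ≤ 2 := by norm_num
    exact div_nonneg (mul_nonneg h2 hCW) (pow_nonneg (prob_nonneg hp _) 2)

end AtB

end A3Fibre

end CovForm

end Summit.Ventures.PercRepro2
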